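import Summits.AtomisticToContinuum.FouriersLaw.Theorems.PhononMeanFreePathDefs
import Summits.AtomisticToContinuum.FouriersLaw.Theorems.IncoherentChannel.Negative.HarmonicWick
import Summits.AtomisticToContinuum.FouriersLaw.Theorems.PhononMeanFreePathIncoherentChannelGlobalFlip

/-!
# The harmonic forecast dictionary (line `two-horizons-forecast-loss`, crux `IncoherentChannel`)

Helper file of line `two-horizons-forecast-loss` of crux `PhononMeanFreePath.IncoherentChannel`
(stmt-AtomisticToContinuum-11811), stub group "HarmonicForecast" (lead c6, W-A): the registered stubs
`harmonic_fcast_eq_freeFlow`, `harmonic_endAutocorr_eq_response`, `harmonic_pairCorr_eq_response`.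

Setting: the pinned HARMONIC chain `P = pinnedChain ω₂ 0 0 γ` (`ω₂ > 0`, `γ ≥ 0`) on `N + 1` sites with both
Langevin baths at `T > 0`, its Gibbs law `μ₀ = P.gibbsMeasure (N+1) T`, the constructed transition kernels
`K_t = P.transitionKernel (N+1) T T t⁺` and the line's vocabulary (`Theorems/PhononMeanFreePathDefs`): the mean
forecast `v_t = fcast … N t = K_t p_N` and the pair correlation `r_N(t) = pairCorr … N t = ⟨p_0, v_t⟩_{μ₀}`.
At the harmonic corner the Langevin drift is linear, so the kernel from `z` is the kernel from rest translated
by the deterministic (zero-noise) damped flow `M_t z = P.chainFlow (N+1) z 0 t`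
(`HarmonicFlow.harmonic_transitionKernel_eq_map`), and `M_t` is a linear map
(`HarmonicFlow.harmonic_chainFlow_zero_noise_linear`). Consequences recorded here:

* `harmonic_fcast_zero` — the forecast from rest vanishes, `v_t(0) = 0` (`v_t` is `Π`-odd, `fcast_neg`);
* `harmonic_fcast_eq_freeFlow` (registered, A1) — `v_t(z) = (M_t z)_{p_N}`: the mean forecast of `p_N` IS the
  deterministic damped flow read on `p_N` (`KernelMoments.harmonic_kernel_momentum` + `v_t(0) = 0`);
* `harmonic_endAutocorr_eq_response` (registered, A2) — the echo `a_N(t) = ⟨p_N, v_t⟩_{μ₀}` equals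
  `T × (M_t e_{p_N})_{p_N}`, the `p_N ← p_N` impulse response (Stein's identity `GibbsStein.gibbs_momentum_mul_clm`
  applied to the continuous linear functional `z ↦ (M_t z)_{p_N}`);
* `harmonic_pairCorr_eq_response` (registered, A3) — `r_N(t) = T × (M_t e_{p_0})_{p_N}`, the `p_N ← p_0` impulse
  response (this is `HarmonicWick.harmonic_rN_eq_response` in the line's vocabulary).
-/

noncomputable section

namespace Summit.AtomisticToContinuum.FouriersLaw.Theorems.PhononMeanFreePath

open MeasureTheory Set Filter Topology
open scoped NNReal
open Literature.MathematicalPhysics.KineticTheory.HeatConduction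
open Summit.AtomisticToContinuum.FouriersLaw.Theorems.IncoherentChannel.Negative.HarmonicFlow
open Summit.AtomisticToContinuum.FouriersLaw.Theorems.IncoherentChannel.Negative.KernelMoments
open Summit.AtomisticToContinuum.FouriersLaw.Theorems.IncoherentChannel.Negative.GibbsStein
open Summit.AtomisticToContinuum.FouriersLaw.Theorems.IncoherentChannel.Negative.HarmonicWick

/-- **The forecast from rest vanishes**: `v_t(0) = 0` for the pinned chain (any `lam, β, γ ≥ 0`), since the
mean forecast is odd under the global flip (`fcast_neg`) and `-0 = 0`. [folklore] -/
theorem harmonic_fcast_zero {ω₂ lam β γ : ℝ} (hω : 0 < ω₂) (hl : 0 ≤ lam) (hβ : 0 ≤ β) (hγ : 0 ≤ γ)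
    (T : ℝ) (N : ℕ) (t : ℝ) : fcast ω₂ lam β γ T N t 0 = 0 := by
  have h := fcast_neg ω₂ lam β γ hω hl hβ hγ T N t 0
  rw [neg_zero] at h
  linarith

/-- **A1. The harmonic mean forecast is the deterministic damped flow** (registered stub
`harmonic_fcast_eq_freeFlow`): for `P = pinnedChain ω₂ 0 0 γ` (`ω₂ > 0`, `γ ≥ 0`), both baths at `T > 0`,
`v_t(z) = (K_t p_N)(z) = (Φ_{t⁺}(z, 0))_{p_N}` — the kernel from `z` is the kernel from rest translated by the
zero-noise flow (`harmonic_kernel_momentum`), and the forecast from rest is `0` (`harmonic_fcast_zero`).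
[folklore] -/
theorem harmonic_fcast_eq_freeFlow : ∀ ω₂ γ : ℝ, 0 < ω₂ → 0 ≤ γ → ∀ T : ℝ, 0 < T → ∀ (N : ℕ) (t : ℝ) (z : PhaseSpace (N + 1)), fcast ω₂ 0 0 γ T N t z = ((pinnedChain ω₂ 0 0 γ).chainFlow (N + 1) z 0 (t.toNNReal : ℝ)).2 (Fin.last N) := by
  intro ω₂ γ hω hγ T hT N t z
  have h0 : fcast ω₂ 0 0 γ T N t 0 = 0 := harmonic_fcast_zero hω le_rfl le_rfl hγ T N t
  have h1 : fcast ω₂ 0 0 γ T N t z =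
      ((pinnedChain ω₂ 0 0 γ).chainFlow (N + 1) z 0 (t.toNNReal : ℝ)).2 (Fin.last N) + fcast ω₂ 0 0 γ T N t 0 := by
    unfold fcast
    exact harmonic_kernel_momentum hω hγ (Nat.succ_pos N) hT t.toNNReal z (Fin.last N)
  rw [h1, h0, add_zero]

/-- **A2. The echo is `T ×` the `p_N ← p_N` impulse response** (registered stub
`harmonic_endAutocorr_eq_response`): `a_N(t) = ⟨p_N, v_t⟩_{μ₀} = T · (Φ_{t⁺}(e_{p_N}, 0))_{p_N}` for the pinned
harmonic chain — by A1 the forecast is the continuous linear functional `z ↦ (M_t z)_{p_N}`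
(`harmonic_chainFlow_zero_noise_linear`), and Stein's identity in the `p_N` direction for the Gibbs measure
(`gibbs_momentum_mul_clm`) evaluates `∫ p_N L dμ₀ = T · L(e_{p_N})`. [folklore] -/
theorem harmonic_endAutocorr_eq_response : ∀ ω₂ γ : ℝ, 0 < ω₂ → 0 ≤ γ → ∀ T : ℝ, 0 < T → ∀ (N : ℕ) (t : ℝ), ∫ z, z.2 (Fin.last N) * fcast ω₂ 0 0 γ T N t z ∂((pinnedChain ω₂ 0 0 γ).gibbsMeasure (N + 1) T) = T * ((pinnedChain ω₂ 0 0 γ).chainFlow (N + 1) ((0, Pi.single (Fin.last N) 1) : PhaseSpace (N + 1)) 0 (t.toNNReal : ℝ)).2 (Fin.last N) := by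
  intro ω₂ γ hω hγ T hT N t
  obtain ⟨M, hM⟩ := harmonic_chainFlow_zero_noise_linear hω hγ (N + 1) (t.toNNReal : ℝ)
  set gL : PhaseSpace (N + 1) →L[ℝ] ℝ :=
    LinearMap.toContinuousLinearMap (((LinearMap.proj (Fin.last N)).comp (LinearMap.snd ℝ _ _)).comp M) with hgL
  have hg : ∀ x, gL x = (M x).2 (Fin.last N) := fun x => rfl
  have hf : ∀ z : PhaseSpace (N + 1), fcast ω₂ 0 0 γ T N t z = gL z := fun z => by
    rw [harmonic_fcast_eq_freeFlow ω₂ γ hω hγ T hT N t z, hM z, hg]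
  simp_rw [hf]
  rw [gibbs_momentum_mul_clm hω le_rfl le_rfl hT (Fin.last N) gL, hg, ← hM]

/-- **A3. Classical fluctuation–dissipation in the line's vocabulary** (registered stub
`harmonic_pairCorr_eq_response`): `r_N(t) = pairCorr … N t = T · (Φ_{t⁺}(e_{p_0}, 0))_{p_N}`, the `p_N ← p_0`
impulse response of the damped harmonic lattice — `HarmonicWick.harmonic_rN_eq_response` once `pairCorr` and
`fcast` are unfolded. [cite: RiederLebowitzLieb1967] -/
theorem harmonic_pairCorr_eq_response : ∀ ω₂ γ : ℝ, 0 < ω₂ → 0 ≤ γ → ∀ T : ℝ, 0 < T → ∀ (N : ℕ) (t : ℝ), pairCorr ω₂ 0 0 γ T N t = T * ((pinnedChain ω₂ 0 0 γ).chainFlow (N + 1) ((0, Pi.single 0 1) : PhaseSpace (N + 1)) 0 (t.toNNReal : ℝ)).2 (Fin.last N) := by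
  intro ω₂ γ hω hγ T hT N t
  simp only [pairCorr, fcast]
  exact harmonic_rN_eq_response hω hγ hT N t

end Summit.AtomisticToContinuum.FouriersLaw.Theorems.PhononMeanFreePath

end
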